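import Literature.NumberTheory.EllipticCurves.Gamma0CocycleDegeneracyMaps
import HarnessLib

/-!
# Congruence homomorphisms on `Γ₀(N)` are shift-invariant at every prime not dividing the congruence level
# (E-es-25 / MEMO-es §21.2, the «Eisenstein edge», torus census)

Summit `BirchSwinnertonDyer`, cruxes C3 `ManinPrimeToThreeAtNine` (stmt-BirchSwinnertonDyer-22968) / C2 `ManinOddAtFour`
(stmt-22967), route `ManinLocalTwoThree` (cell bsd-f2-manin), through E-es-25 (relative Ihara at a prime dividing the
level, MEMO-es §21).  The bottom step (5) of §21.2 ends with a homomorphism `u : Γ₀(N) → R` that kills a principal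
congruence subgroup `Γ(M)` (output of the congruence subgroup property of `SL₂(ℤ[1/t])`, tree theorem
`SerreSL2Congruence1970_congruenceSubgroupProperty_away_holds`); this file proves that such a `u` is SHIFT-INVARIANT at
every `ℓ ≥ 1` coprime to `M`: `π_ℓ^* u = π_1^* u` on `Γ₀(Nℓ)`, i.e. `u(a, ℓb; c/ℓ, d) = u(a, b; c, d)`
(`shiftInvariant_of_congruence`), provided the coefficients satisfy the torsion condition
«`M·r = 0 ⟹ (x − 1)·r = 0` for `x` coprime to `M`» (true in `𝔽_p` when `p ∤ M`, and in `𝔽₂` for every `M`; false in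
`𝔽₃` when `3 ∣ M` — the cubic character of `SL₂(ℤ)`).  With the sibling file
`ManinLocalTwoThreeShiftInvariantHeckeEigenvalue.lean` this gives `T_ℓ u = (ℓ + 1) u` for every prime `ℓ ∤ NM`: congruence
homomorphisms are Eisenstein.  PROOF (no Bruhat decomposition, no surjectivity of `SL₂(ℤ) → SL₂(ℤ/M)` needed): after a
left unipotent adjustment making `a` a unit modulo `M` (`exists_isCoprime_add_mul`), the torus conjugate is congruent to an
explicit product, `(a, ℓb; c/ℓ, d) ≡ (1 0; s 1)(a b; c d)(1 r; 0 1) (mod M)` with `r = (ℓ−1)a*b`, `s = (c/ℓ − c)a*`,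
`a a* ≡ 1`, and `u` of the two unipotent factors vanishes by the torsion condition.

Nothing about BSD or Manin's conjecture is proved here.  References: MEMO-es §21.2; [DarmonDiamondTaylor1995] §4.3
(Eisenstein maximal ideals); [Shimura1971] §8.3.
-/

set_option autoImplicit false
set_option linter.dupNamespace false

open scoped MatrixGroups

open CongruenceSubgroup Literature.NumberTheory.EllipticCurves.ModularForms
  Literature.NumberTheory.EllipticCurves.ModularForms.HidaCohomology

namespace Summit.BirchSwinnertonDyer.BirchSwinnertonDyer.Theorems.ManinLocalTwoThree

section Arithmetic

/-- **Coprime shift**: if `gcd(a, c) = 1` then some `a + x c` is coprime to `M ≥ 1` (take `x = (1 − a) c^{M! − 1}`: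
modulo a prime `q ∣ M`, `c^{M!} ≡ 1` if `q ∤ c` (Fermat, `q − 1 ∣ M!`) so `a + x c ≡ 1`, and `≡ a ≢ 0` if `q ∣ c`).
[folklore] -/
theorem exists_isCoprime_add_mul (a c : ℤ) (hac : IsCoprime a c) (M : ℕ) (hM : 0 < M) :
    ∃ x : ℤ, IsCoprime (a + x * c) (M : ℤ) := by
  refine ⟨(1 - a) * c ^ (M.factorial - 1), ?_⟩
  have hpow : (a + (1 - a) * c ^ (M.factorial - 1) * c) = a + (1 - a) * c ^ M.factorial := by
    rw [mul_assoc, ← pow_succ, Nat.sub_add_cancel (Nat.one_le_iff_ne_zero.mpr (Nat.factorial_ne_zero M))]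
  rw [hpow, Int.isCoprime_iff_gcd_eq_one, Int.gcd_eq_natAbs, Int.natAbs_natCast]
  -- no prime `q ∣ M` divides `z = a + (1 − a) c^{M!}`
  apply Nat.coprime_of_dvd
  intro q hq hqz hqM
  have hqz' : (q : ℤ) ∣ a + (1 - a) * c ^ M.factorial := Int.natCast_dvd.mpr hqz
  haveI : Fact q.Prime := ⟨hq⟩
  have hqle : q ≤ M := Nat.le_of_dvd hM hqM
  by_cases hqc : (q : ℤ) ∣ c
  · -- `q ∣ c`: then `q ∣ a`, contradicting `gcd(a,c) = 1`
    have hqa : (q : ℤ) ∣ a := by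
      have h1 : (q : ℤ) ∣ (1 - a) * c ^ M.factorial :=
        (dvd_pow hqc (Nat.factorial_ne_zero M)).mul_left _
      simpa using (dvd_sub hqz' h1)
    obtain ⟨u, v, huv⟩ := hac
    have h1 : (q : ℤ) ∣ 1 := huv ▸ dvd_add (hqa.mul_left u) (hqc.mul_left v)
    exact hq.ne_one (Nat.dvd_one.mp (by exact_mod_cast h1))
  · -- `q ∤ c`: Fermat gives `c^{M!} ≡ 1`, so `z ≡ 1 (mod q)`
    have hF : ((c : ZMod q)) ^ M.factorial = 1 := by
      have hc0 : (c : ZMod q) ≠ 0 := by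
        intro h
        exact hqc ((ZMod.intCast_zmod_eq_zero_iff_dvd c q).mp h)
      have hdvd : q - 1 ∣ M.factorial := Nat.dvd_factorial (by have := hq.one_lt; omega) (by omega)
      obtain ⟨k, hk⟩ := hdvd
      rw [hk, pow_mul, ZMod.pow_card_sub_one_eq_one hc0, one_pow]
    have h0 : ((a + (1 - a) * c ^ M.factorial : ℤ) : ZMod q) = 0 :=
      (ZMod.intCast_zmod_eq_zero_iff_dvd _ q).mpr hqz'
    push_cast at h0
    rw [hF] at h0
    have : (1 : ZMod q) = 0 := by linear_combination h0
    exact one_ne_zero this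

end Arithmetic


section Unipotents

variable {N : ℕ} {R : Type*} [CommRing R]

/-- Membership in `Γ₀(N)` from the lower-left entry (plumbing). [folklore] -/
theorem mem_Gamma0_of_dvd_apply_one_zero (A : SL(2, ℤ)) (hA : (N : ℤ) ∣ A 1 0) : A ∈ Gamma0 N := by
  rw [Gamma0_mem]
  exact (ZMod.intCast_zmod_eq_zero_iff_dvd _ N).mpr hA

/-- **A one-parameter family in `Γ₀(N)` through a degree-`0` cocycle is `ℤ`-linear**: if `g : ℤ → Γ₀(N)` satisfies
`g (x + y) = g x * g y` then `u (g x) = x • u (g 1)` (plumbing for the unipotent families `(1 x; 0 1)`,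
`(1 0; N y 1)`). [folklore] -/
theorem cocycle_zero_apply_oneParam {u : Gamma0 N → Fin 1 → R} (hu : u ∈ cocycles 0 N R) (g : ℤ → Gamma0 N)
    (hg : ∀ x y, g (x + y) = g x * g y) (x : ℤ) : u (g x) = x • u (g 1) := by
  have h0 : g 0 = 1 := by
    have := hg 0 0
    rw [add_zero] at this
    exact left_eq_mul.mp this |>.symm ▸ rfl
  let ψ : ℤ →+ (Fin 1 → R) :=
    { toFun := fun x ↦ u (g x)
      map_zero' := by
        show u (g 0) = 0
        rw [h0]; exact cocycle_map_one hu
      map_add' := fun x y ↦ by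
        show u (g (x + y)) = u (g x) + u (g y)
        rw [hg, (mem_cocycles_iff.mp hu), act_zero_eq_id, LinearMap.id_apply, add_comm] }
  have : ψ = zmultiplesHom (Fin 1 → R) (ψ 1) := AddMonoidHom.ext_int (by simp)
  have hx := DFunLike.congr_fun this x
  simpa [ψ] using hx

end Unipotents


section Census

variable {N M : ℕ} {R : Type*} [CommRing R]

/-- **Congruence homomorphisms are shift-invariant away from the congruence level** (the torus census of the
«Eisenstein edge», MEMO-es §21.2 (1)/(5)).  Let `u` be a degree-`0` cocycle on `Γ₀(N)` which factors through
reduction modulo `M` (`hF`: `u γ₁ = u γ₂` whenever `γ₁ ≡ γ₂` entrywise mod `M`), with coefficients in which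
`M r = 0 ⟹ (x − 1) r = 0` for every `x` coprime to `M` (`hR`; e.g. `𝔽_p` with `p ∤ M`, or `𝔽₂`).  Then for every
`ℓ ≥ 1` coprime to `M` and every level `L` with `N ℓ ∣ L`: `π_ℓ^* u = π_1^* u` on `Γ₀(L)`, i.e.
`u(a, ℓb; c/ℓ, d) = u(a, b; c, d)`.  Proof: left-multiply by `(1 x; 0 1)` to make `a` a unit mod `M`
(`exists_isCoprime_add_mul`); then `(a, ℓb; c/ℓ, d) ≡ (1 0; s 1)(a b; c d)(1 r; 0 1)` with `r = (ℓ−1) a* b`,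
`s = (c/ℓ − c) a*`, `a a* ≡ 1 (mod M)`, and `u` of the unipotent factors is `r·u(1 1;0 1)`, `(s/N)·u(1 0;N 1)`, both
killed by `hR` since `M·u(1 1; 0 1) = u((1 1;0 1)^M) = u(1) = 0`. [folklore] -/
theorem shiftInvariant_of_congruence [NeZero M] {u : Gamma0 N → Fin 1 → R} (hu : u ∈ cocycles 0 N R)
    (hF : ∀ γ₁ γ₂ : Gamma0 N, (∀ i j, ((gmat γ₁ i j : ℤ) : ZMod M) = ((gmat γ₂ i j : ℤ) : ZMod M)) → u γ₁ = u γ₂)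
    (hR : ∀ r : R, (M : ℤ) • r = 0 → ∀ x : ℤ, IsCoprime x M → (x - 1) • r = 0)
    {ℓ : ℕ} [NeZero ℓ] (hℓM : IsCoprime (ℓ : ℤ) M) {L : ℕ} (hL1 : N * 1 ∣ L) (hLℓ : N * ℓ ∣ L) :
    degeneracyPullback 0 N L ℓ R hLℓ u = degeneracyPullback 0 N L 1 R hL1 u := by
  have hM0 : 0 < M := Nat.pos_of_ne_zero (NeZero.ne M)
  have hℓ0 : (ℓ : ℤ) ≠ 0 := by exact_mod_cast NeZero.ne ℓ
  -- `hR` on the module `Fin 1 → R`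
  have hR' : ∀ v : Fin 1 → R, (M : ℤ) • v = 0 → ∀ x : ℤ, IsCoprime x M → (x - 1) • v = 0 := by
    intro v hv x hx
    funext k
    have := congrFun hv k
    simpa using hR (v k) (by simpa using this) x hx
  -- the unipotent one-parameter families
  let Um : ℤ → SL(2, ℤ) := fun x ↦ ⟨!![1, x; 0, 1], by rw [Matrix.det_fin_two_of]; ring⟩
  let U : ℤ → Gamma0 N := fun x ↦ ⟨Um x, mem_Gamma0_of_dvd_apply_one_zero (Um x) (by simp [Um])⟩
  let Vm : ℤ → SL(2, ℤ) := fun y ↦ ⟨!![1, 0; (N : ℤ) * y, 1], by rw [Matrix.det_fin_two_of]; ring⟩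
  let V : ℤ → Gamma0 N := fun y ↦ ⟨Vm y, mem_Gamma0_of_dvd_apply_one_zero (Vm y) (by simp [Vm])⟩
  have hUadd : ∀ x y, U (x + y) = U x * U y := by
    intro x y
    apply Subtype.ext; ext i j
    fin_cases i <;> fin_cases j <;> simp [U, Um, Matrix.mul_apply, Fin.sum_univ_two, add_comm]
  have hVadd : ∀ x y, V (x + y) = V x * V y := by
    intro x y
    apply Subtype.ext; ext i j
    fin_cases i <;> fin_cases j <;> simp [V, Vm, Matrix.mul_apply, Fin.sum_univ_two, mul_add, add_comm]
  have hUlin : ∀ x, u (U x) = x • u (U 1) := cocycle_zero_apply_oneParam hu U hUadd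
  have hVlin : ∀ y, u (V y) = y • u (V 1) := cocycle_zero_apply_oneParam hu V hVadd
  -- `M · u(U 1) = 0 = M · u(V 1)` (the `M`-th powers are `≡ 1 mod M`)
  have hmul : ∀ γ δ : Gamma0 N, u (γ * δ) = u γ + u δ := fun γ δ ↦ by
    rw [(mem_cocycles_iff.mp hu) γ δ, act_zero_eq_id, LinearMap.id_apply, add_comm]
  have hUM : (M : ℤ) • u (U 1) = 0 := by
    rw [← hUlin, ← cocycle_map_one hu]
    apply hF
    intro i j
    fin_cases i <;> fin_cases j <;> simp [gmat, U, Um]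
  have hVM : (M : ℤ) • u (V 1) = 0 := by
    rw [← hVlin, ← cocycle_map_one hu]
    apply hF
    intro i j
    fin_cases i <;> fin_cases j <;> simp [gmat, V, Vm]
  have hU0 : ∀ k : ℤ, (k * ((ℓ : ℤ) - 1)) • u (U 1) = 0 := by
    intro k; rw [mul_smul, hR' _ hUM ℓ hℓM, smul_zero]
  have hV0 : ∀ k : ℤ, (k * ((ℓ : ℤ) - 1)) • u (V 1) = 0 := by
    intro k; rw [mul_smul, hR' _ hVM ℓ hℓM, smul_zero]
  -- the two conjugates of `γ`
  funext γ
  rw [degeneracyPullback_zero_apply, degeneracyPullback_one_apply]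
  set γ₁ : Gamma0 N := Gamma0.degeneracyConj N L 1 hL1 γ with hγ₁
  set γ₂ : Gamma0 N := Gamma0.degeneracyConj N L ℓ hLℓ γ with hγ₂
  set a : ℤ := (γ : SL(2, ℤ)) 0 0 with ha
  set b : ℤ := (γ : SL(2, ℤ)) 0 1 with hb
  set c : ℤ := (γ : SL(2, ℤ)) 1 0 with hc
  set d : ℤ := (γ : SL(2, ℤ)) 1 1 with hd
  have hdet : a * d - b * c = 1 := by
    have h := Matrix.det_fin_two (γ : SL(2, ℤ)).1
    rw [(γ : SL(2, ℤ)).2] at h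
    rw [ha, hb, hc, hd]; linarith
  -- `c = ℓ N c''`
  obtain ⟨c'', hc''⟩ : (N : ℤ) * ℓ ∣ c := by
    have hLc : (L : ℤ) ∣ c := by
      have h := γ.2
      rw [Gamma0_mem] at h
      exact (ZMod.intCast_zmod_eq_zero_iff_dvd _ L).mp h
    exact (show (N : ℤ) * ℓ ∣ (L : ℤ) by exact_mod_cast hLℓ).trans hLc
  -- entries of `γ₁`, `γ₂`
  have e₁ : gmat γ₁ = !![a, b; c, d] := by
    rw [gmat, hγ₁, Gamma0.coe_degeneracyConj_one]
    ext i j; fin_cases i <;> fin_cases j <;> rfl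
  have e₂ : gmat γ₂ = !![a, (ℓ : ℤ) * b; (N : ℤ) * c'', d] := by
    ext i j
    fin_cases i <;> fin_cases j
    · simp [gmat, hγ₂, Gamma0.degeneracyConjElt, ha]
    · simp [gmat, hγ₂, Gamma0.degeneracyConjElt, hb]
    · simp only [gmat, hγ₂, Gamma0.degeneracyConj_apply]
      change c / ℓ = _
      rw [hc'', show (N : ℤ) * ℓ * c'' = ℓ * (N * c'') by ring, Int.mul_ediv_cancel_left _ hℓ0]
      rfl
    · simp [gmat, hγ₂, Gamma0.degeneracyConjElt, hd]
  -- Step 1: make `a` a unit modulo `M`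
  have hac : IsCoprime a c := ⟨d, -b, by linear_combination hdet⟩
  obtain ⟨x, hx⟩ := exists_isCoprime_add_mul a c hac M hM0
  obtain ⟨astar, q, hq⟩ := hx
  set at' : ℤ := a + x * c with hat
  set bt : ℤ := b + x * d with hbt
  set γt₁ : Gamma0 N := U x * γ₁ with hγt₁
  set γt₂ : Gamma0 N := U (ℓ * x) * γ₂ with hγt₂
  have et₁ : gmat γt₁ = !![at', bt; c, d] := by
    rw [hγt₁, gmat_mul, e₁]
    ext i j; fin_cases i <;> fin_cases j <;> simp [gmat, U, Um, Matrix.mul_apply, Fin.sum_univ_two, hat, hbt]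
  have et₂ : gmat γt₂ = !![at', (ℓ : ℤ) * bt; (N : ℤ) * c'', d] := by
    rw [hγt₂, gmat_mul, e₂]
    ext i j
    fin_cases i <;> fin_cases j <;> simp [gmat, U, Um, Matrix.mul_apply, Fin.sum_univ_two, hat, hbt]
    · linear_combination (-x) * hc''
    · ring
  -- Step 2: the explicit congruence `γt₂ ≡ V y · γt₁ · U r (mod M)`
  set r : ℤ := ((ℓ : ℤ) - 1) * astar * bt with hr
  set y : ℤ := c'' * (1 - (ℓ : ℤ)) * astar with hy
  set Z : Gamma0 N := V y * γt₁ * U r with hZ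
  have eZ : gmat Z = !![at', at' * r + bt; (N : ℤ) * y * at' + c, ((N : ℤ) * y * at' + c) * r + (N : ℤ) * y * bt + d] := by
    rw [hZ, gmat_mul, gmat_mul, et₁]
    ext i j
    fin_cases i <;> fin_cases j <;> simp [gmat, U, Um, V, Vm, Matrix.mul_apply, Fin.sum_univ_two]
    ring
  have hcong : ∀ i j, ((gmat γt₂ i j : ℤ) : ZMod M) = ((gmat Z i j : ℤ) : ZMod M) := by
    intro i j
    rw [et₂, eZ, ZMod.intCast_eq_intCast_iff_dvd_sub]
    fin_cases i <;> fin_cases j <;>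
      simp only [Fin.zero_eta, Fin.mk_one, Fin.isValue, Matrix.of_apply, Matrix.cons_val_zero,
        Matrix.cons_val_one]
    · simp
    · exact ⟨-((ℓ : ℤ) - 1) * bt * q, by linear_combination at' * hr + ((ℓ : ℤ) - 1) * bt * hq⟩
    · exact ⟨(N : ℤ) * c'' * ((ℓ : ℤ) - 1) * q, by
        linear_combination (N : ℤ) * at' * hy + hc'' + (N : ℤ) * c'' * (1 - (ℓ : ℤ)) * hq⟩
    · exact ⟨-r * (N : ℤ) * c'' * (1 - (ℓ : ℤ)) * q, by
        linear_combination (N : ℤ) * (r * at' + bt) * hy + r * hc'' + (N : ℤ) * c'' * hr +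
          r * (N : ℤ) * c'' * (1 - (ℓ : ℤ)) * hq⟩
  -- Step 3: evaluate `u`
  have huZ : u γt₂ = u γt₁ := by
    rw [hF γt₂ Z hcong, hZ, hmul, hmul, hVlin, hUlin,
      show y = (-(c'' * astar)) * ((ℓ : ℤ) - 1) by rw [hy]; ring, hV0,
      show r = (astar * bt) * ((ℓ : ℤ) - 1) by rw [hr]; ring, hU0, zero_add, add_zero]
  have hUx : u (U ((ℓ : ℤ) * x)) = u (U x) := by
    rw [hUlin, hUlin x, ← sub_eq_zero, ← sub_smul, show (ℓ : ℤ) * x - x = x * ((ℓ : ℤ) - 1) by ring, hU0]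
  rw [hγt₂, hγt₁, hmul, hmul, hUx] at huZ
  exact add_left_cancel huZ


/-- **Kernel form ⟹ congruence form.**  If a degree-`0` cocycle `u` on `Γ₀(N)` kills every element congruent to `1`
modulo `M` (i.e. `Γ₀(N) ∩ Γ(M) ⊆ ker u` — the output of the congruence subgroup property), then `u γ₁ = u γ₂` whenever
`γ₁ ≡ γ₂` entrywise modulo `M` (the hypothesis `hF` of `shiftInvariant_of_congruence`). [folklore] -/
theorem congr_of_kills_principalCongruence [NeZero M] {u : Gamma0 N → Fin 1 → R} (hu : u ∈ cocycles 0 N R)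
    (hK : ∀ γ : Gamma0 N, (∀ i j, ((gmat γ i j : ℤ) : ZMod M) = (((1 : Matrix (Fin 2) (Fin 2) ℤ) i j : ℤ) : ZMod M)) →
      u γ = 0)
    (γ₁ γ₂ : Gamma0 N) (h : ∀ i j, ((gmat γ₁ i j : ℤ) : ZMod M) = ((gmat γ₂ i j : ℤ) : ZMod M)) : u γ₁ = u γ₂ := by
  -- reduction modulo `M` as a ring homomorphism on matrices
  let red : Matrix (Fin 2) (Fin 2) ℤ →+* Matrix (Fin 2) (Fin 2) (ZMod M) := (Int.castRingHom (ZMod M)).mapMatrix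
  have hred : ∀ γ : Gamma0 N, (∀ i j, ((gmat γ i j : ℤ) : ZMod M) = (red (gmat γ)) i j) := fun γ i j ↦ rfl
  have h12 : red (gmat γ₁) = red (gmat γ₂) := by
    ext i j; exact h i j
  have hinv : red (gmat γ₂⁻¹) * red (gmat γ₂) = 1 := by
    rw [← map_mul, ← gmat_mul, inv_mul_cancel, gmat_one, map_one]
  have hprod : red (gmat (γ₁ * γ₂⁻¹)) = 1 := by
    rw [gmat_mul, map_mul, h12]
    -- `red γ₂ * red γ₂⁻¹ = 1` from `red γ₂⁻¹ * red γ₂ = 1` (finite matrices: left inverse = right inverse)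
    exact mul_eq_one_comm.mp hinv
  have hk : u (γ₁ * γ₂⁻¹) = 0 := by
    apply hK
    intro i j
    rw [hred, hprod]
    fin_cases i <;> fin_cases j <;> simp
  have hmul : u (γ₁ * γ₂⁻¹) = u γ₁ + u γ₂⁻¹ := by
    rw [(mem_cocycles_iff.mp hu), act_zero_eq_id, LinearMap.id_apply, add_comm]
  rw [hmul, cocycle_map_inv hu, act_zero_eq_id, LinearMap.id_apply, ← sub_eq_add_neg, sub_eq_zero] at hk
  exact hk

end Census

end Summit.BirchSwinnertonDyer.BirchSwinnertonDyer.Theorems.ManinLocalTwoThree
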